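import Literature.NumberTheory.EllipticCurves.ZpExtensionLocalUnitsProofs
import HarnessLib

/-!
# `p`-th roots of principal units from level one, for ODD `p` (proofs only, no definitions)

Topic `NumberTheory/EllipticCurves` (local units above `p`; sequel to `ZpExtensionLocalUnitsProofs`, whose
root extraction `PRamified.exists_pow_prime_eq_of_mem_W` starts at level two: `W_{k+3} ⊆ W_{k+2}ᵖ` for EVERY
prime `p`).  For an ODD prime `p` the extraction starts one level lower:

* `exists_one_add_prime_pow_mul_pow_odd` — `(1 + p^{k+1} a)ᵖ = 1 + p^{k+2} (a + p c)` for some `c`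
  (the binomial coefficients `C(p,i)`, `0 < i < p`, are divisible by `p`, and `p(k+1) ≥ k+3` for `p ≥ 3`);
* `exists_inv_mul_pow_mem_W_odd` / `exists_inv_mul_pow_mem_W_add_odd` — one step / iterated `p`-th root
  extraction from level `k+1`: for `w ∈ W_{k+2}` there is `u ∈ W_{k+1}` with `w⁻¹ uᵖ ∈ W_{k+3+j}`;
* **`exists_pow_prime_eq_of_mem_W_odd`** — `W_{k+2} ⊆ W_{k+1}ᵖ` (`W_{k+1}ᵖ` is compact, hence closed);
* **`exists_pow_prime_pow_eq_of_mem_W_odd`** — `W_{k+1} ⊆ W₁^{p^k}`, i.e.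
  `1 + p^{k+1} ∏_v 𝒪_v ⊆ (1 + p ∏_v 𝒪_v)^{p^k}`;
* **`exists_units_pow_prime_pow_eq_one_add_odd`** — the one-place form: for `v ∣ p` and `x ∈ 𝒪_v` there is a
  unit `u ≡ 1 (mod p𝒪_v)` with `u^{p^k} = 1 + p^{k+1} x`.

Here, as in `ZpExtensionLocalUnitsProofs`, `W : ℕ → Subgroup (LocalUnits K p)` is any family with the membership
description `hW` (`u ∈ W_k ↔ u_v ≡ 1 (mod pᵏ𝒪_v)` for all `v ∣ p`); no subgroup is introduced as a definition.
This is the classical statement `U^{(n)}` `≅` `𝔭ⁿ` via `log`/`exp` for `n > e/(p-1)` (Neukirch, *Algebraic Number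
Theory*, II (5.5)) in the special case needed for ring class towers over an imaginary quadratic field at an odd
prime: `(1 + p𝒪_w)^{p^k} ⊇ 1 + p^{k+1}𝒪_w` (Cox, *Primes of the form x² + ny²*, Thm. 7.24 / Lemma 15.20;
Cornut–Vatsal 2007, Lemma 2.1), proved here WITHOUT logarithms by successive approximation.  For `p = 2` the
statement fails at level one (`-1 ∈ 1 + 2ℤ₂` has no square root), which is why the all-`p` file starts at level two.

References: J. Neukirch, *Algebraic Number Theory*, Springer 1999, Ch. II (5.5); J.-P. Serre, *Local Fields*,
GTM 67, Ch. IV §3 Prop. 9; S. Lang, *Cyclotomic Fields I and II*, GTM 121, Ch. 5 §5.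
-/

noncomputable section

open scoped NumberField
open Filter Topology IsDedekindDomain

universe u

namespace Literature.NumberTheory.EllipticCurves

namespace PRamified

/-! ### The binomial identity for odd `p` -/

section Algebra

variable {O : Type*} [CommRing O]

/-- **`(1 + p^{k+1} a)ᵖ = 1 + p^{k+2} (a + p c)` for an odd prime `p`** (for some `c`): the middle binomial
coefficients are divisible by `p` and the last term `p^{p(k+1)} aᵖ` has `p(k+1) ≥ k+3`.
[cite: SerreLocalFields1979, Ch. IV §3 Prop. 9] [cite: NeukirchANT1999, Ch. II (5.5)] -/
theorem exists_one_add_prime_pow_mul_pow_odd {p : ℕ} (hp : p.Prime) (hodd : Odd p) (k : ℕ) (a : O) :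
    ∃ c : O, (1 + (p : O) ^ (k + 1) * a) ^ p = 1 + (p : O) ^ (k + 2) * (a + (p : O) * c) := by
  have hp3 : 3 ≤ p := by
    rcases hodd with ⟨r, hr⟩
    have h2 := hp.two_le
    omega
  set X : O := (p : O) ^ (k + 1) * a with hX
  -- `(X + 1)^p = X^p + 1 + p * ∑_{0<i<p} X^i C(p,i)/p`
  have hbin := add_pow_prime_eq' hp X 1
  -- split off the term `i = 1` of the sum: `∑_{0<i<p} = X + X² s`
  have hsum : ∃ s : O, ∑ i ∈ Finset.Ioo 0 p, X ^ i * (1 : O) ^ (p - i) * ((p.choose i / p : ℕ) : O) =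
      X + X ^ 2 * s := by
    have hIoo : Finset.Ioo 0 p = insert 1 (Finset.Ioo 1 p) := by
      rw [Finset.Ioo_insert_left (by omega : 1 < p)]
      ext i
      simp only [Finset.mem_Ioo, Finset.mem_Ico]
      omega
    rw [hIoo, Finset.sum_insert (by simp)]
    refine ⟨∑ i ∈ Finset.Ioo 1 p, X ^ (i - 2) * (1 : O) ^ (p - i) * ((p.choose i / p : ℕ) : O), ?_⟩
    rw [Nat.choose_one_right, Nat.div_self hp.pos, Nat.cast_one, one_pow, mul_one, mul_one, pow_one,
      Finset.mul_sum]
    congr 1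
    refine Finset.sum_congr rfl fun i hi => ?_
    rw [Finset.mem_Ioo] at hi
    rw [← mul_assoc, ← mul_assoc, ← pow_add, show 2 + (i - 2) = i by omega]
  obtain ⟨s, hs⟩ := hsum
  rw [hs] at hbin
  -- `p (k+1) = (k+3) + d`
  obtain ⟨d, hd⟩ : ∃ d, (k + 1) * p = (k + 3) + d := by
    refine Nat.exists_eq_add_of_le ?_
    have := Nat.mul_le_mul_left (k + 1) hp3
    omega
  refine ⟨(p : O) ^ d * a ^ p + (p : O) ^ k * (a ^ 2 * s), ?_⟩
  rw [add_comm (1 : O) X, hbin, hX]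
  rw [mul_pow, ← pow_mul, hd]
  ring

end Algebra

/-! ### Root extraction from level one in `U_p = ∏_{v ∣ p} 𝒪_vˣ` -/

section Global

variable {K : Type u} [Field K] [NumberField K] {p : ℕ} [Fact p.Prime]

variable {W : ℕ → Subgroup (LocalUnits K p)}

/-- **One step of `p`-th root extraction from level `k+1` (odd `p`)**: for `w ∈ W_{k+2}` there is
`u ∈ W_{k+1}` with `w⁻¹ uᵖ ∈ W_{k+3}` (`(1 + p^{k+1}y)ᵖ ≡ 1 + p^{k+2}y (mod p^{k+3})` for odd `p`).
[cite: SerreLocalFields1979, Ch. IV §3 Prop. 9] [cite: NeukirchANT1999, Ch. II (5.5)] -/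
theorem exists_inv_mul_pow_mem_W_odd (hodd : Odd p)
    (hW : ∀ (k : ℕ) (u : LocalUnits K p), u ∈ W k ↔
      ∀ v, ∃ x : v.1.adicCompletionIntegers K,
        ((u v : (v.1.adicCompletionIntegers K)ˣ) : v.1.adicCompletionIntegers K) =
          1 + (p : v.1.adicCompletionIntegers K) ^ k * x)
    {k : ℕ} {w : LocalUnits K p} (hw : w ∈ W (k + 2)) :
    ∃ u ∈ W (k + 1), w⁻¹ * u ^ p ∈ W (k + 3) := by
  rw [hW] at hw
  choose y hy using hw
  let u : LocalUnits K p := fun v => (isUnit_one_add_prime_pow_mul v.1 v.2 k (y v)).unit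
  have hu : ∀ v, ((u v : (v.1.adicCompletionIntegers K)ˣ) : v.1.adicCompletionIntegers K) =
      1 + (p : v.1.adicCompletionIntegers K) ^ (k + 1) * y v := fun v =>
    (isUnit_one_add_prime_pow_mul v.1 v.2 k (y v)).unit_spec
  refine ⟨u, (hW _ _).2 fun v => ⟨y v, hu v⟩, (hW _ _).2 fun v => ?_⟩
  obtain ⟨c, hc⟩ := exists_one_add_prime_pow_mul_pow_odd (O := v.1.adicCompletionIntegers K)
    (Fact.out : p.Prime) hodd k (y v)
  -- `(u v)^p = w v + p^(k+3) c`, so `w v⁻¹ (u v)^p = 1 + p^(k+3) (c (w v)⁻¹)`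
  refine ⟨c * (((w v)⁻¹ : (v.1.adicCompletionIntegers K)ˣ) : v.1.adicCompletionIntegers K), ?_⟩
  have hwinv : (((w v)⁻¹ : (v.1.adicCompletionIntegers K)ˣ) : v.1.adicCompletionIntegers K) *
      (1 + (p : v.1.adicCompletionIntegers K) ^ (k + 2) * y v) = 1 := by
    rw [← hy v, Units.inv_mul]
  rw [Pi.mul_apply, Pi.inv_apply, Pi.pow_apply, Units.val_mul, Units.val_pow_eq_pow_val, hu v, hc]
  linear_combination hwinv

/-- Iterated root extraction from level `k+1` (odd `p`): for `w ∈ W_{k+2}` and every `j` there is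
`u ∈ W_{k+1}` with `w⁻¹ uᵖ ∈ W_{k+3+j}`. [cite: SerreLocalFields1979, Ch. IV §3 Prop. 9] -/
theorem exists_inv_mul_pow_mem_W_add_odd (hodd : Odd p)
    (hW : ∀ (k : ℕ) (u : LocalUnits K p), u ∈ W k ↔
      ∀ v, ∃ x : v.1.adicCompletionIntegers K,
        ((u v : (v.1.adicCompletionIntegers K)ˣ) : v.1.adicCompletionIntegers K) =
          1 + (p : v.1.adicCompletionIntegers K) ^ k * x)
    {k : ℕ} {w : LocalUnits K p} (hw : w ∈ W (k + 2)) (j : ℕ) :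
    ∃ u ∈ W (k + 1), w⁻¹ * u ^ p ∈ W (k + 3 + j) := by
  induction j with
  | zero => simpa using exists_inv_mul_pow_mem_W_odd hodd hW hw
  | succ j ih =>
    obtain ⟨u, hu, hwu⟩ := ih
    have hwu' : w⁻¹ * u ^ p ∈ W (k + 1 + j + 2) := by
      rw [show k + 1 + j + 2 = k + 3 + j by ring]
      exact hwu
    obtain ⟨u', hu', hwu''⟩ := exists_inv_mul_pow_mem_W_odd hodd hW hwu'
    refine ⟨u * u'⁻¹, mul_mem hu (inv_mem (W_antitone hW (by omega) hu')), ?_⟩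
    have : w⁻¹ * (u * u'⁻¹) ^ p = ((w⁻¹ * u ^ p)⁻¹ * u' ^ p)⁻¹ := by
      rw [mul_pow, inv_pow, mul_inv_rev, inv_inv, mul_comm ((u' ^ p)⁻¹), mul_assoc]
    rw [this]
    refine inv_mem ?_
    rw [show k + 3 + (j + 1) = k + 1 + j + 3 by ring]
    exact hwu''

/-- **`W_{k+2} ⊆ W_{k+1}ᵖ` for odd `p`**: every element of `W_{k+2}` is a `p`-th power of an element of
`W_{k+1}` (successive approximation from level one; `W_{k+1}ᵖ` is compact, hence closed).
[cite: NeukirchANT1999, Ch. II (5.5)] [cite: SerreLocalFields1979, Ch. IV §3 Prop. 9] -/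
theorem exists_pow_prime_eq_of_mem_W_odd (hodd : Odd p)
    (hW : ∀ (k : ℕ) (u : LocalUnits K p), u ∈ W k ↔
      ∀ v, ∃ x : v.1.adicCompletionIntegers K,
        ((u v : (v.1.adicCompletionIntegers K)ˣ) : v.1.adicCompletionIntegers K) =
          1 + (p : v.1.adicCompletionIntegers K) ^ k * x)
    {k : ℕ} {w : LocalUnits K p} (hw : w ∈ W (k + 2)) : ∃ u ∈ W (k + 1), u ^ p = w := by
  haveI : ∀ v : placesAbove K p, CompactSpace (v.1.adicCompletionIntegers K) := fun v =>
    Literature.NumberTheory.Automorphic.compactSpace_adicCompletionIntegers' K v.1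
  -- the image of `W_{k+1}` under `u ↦ u^p` is closed
  have hWc : IsClosed ((W (k + 1) : Set (LocalUnits K p))) :=
    Subgroup.isClosed_of_isOpen _ (isOpen_W hW (k + 1))
  have hS : IsClosed ((fun u : LocalUnits K p => u ^ p) '' (W (k + 1) : Set (LocalUnits K p))) :=
    (hWc.isCompact.image (continuous_pow p)).isClosed
  -- and `w` is in its closure
  have hmem : w ∈ closure ((fun u : LocalUnits K p => u ^ p) '' (W (k + 1) : Set (LocalUnits K p))) := by
    rw [mem_closure_iff_nhds]
    intro U hU
    have hU' : (fun g => w * g) ⁻¹' U ∈ 𝓝 (1 : LocalUnits K p) :=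
      (continuous_const.mul continuous_id).continuousAt.preimage_mem_nhds (by simpa using hU)
    obtain ⟨j, hj⟩ := exists_W_subset hW hU'
    obtain ⟨u, hu, hwu⟩ := exists_inv_mul_pow_mem_W_add_odd hodd hW hw j
    have hin : w⁻¹ * u ^ p ∈ W j := W_antitone hW (by omega) hwu
    refine ⟨u ^ p, ?_, u, hu, rfl⟩
    have := hj hin
    simpa using this
  rw [hS.closure_eq] at hmem
  obtain ⟨u, hu, huw⟩ := hmem
  exact ⟨u, hu, huw⟩

/-- **`W_{k+1} ⊆ W₁^{p^k}` for odd `p`**: `1 + p^{k+1} ∏_v 𝒪_v ⊆ (1 + p ∏_v 𝒪_v)^{p^k}` — every element of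
`W_{k+1}` is a `p^k`-th power of an element of `W₁`. [cite: NeukirchANT1999, Ch. II (5.5)]
[cite: SerreLocalFields1979, Ch. IV §3 Prop. 9] -/
theorem exists_pow_prime_pow_eq_of_mem_W_odd (hodd : Odd p)
    (hW : ∀ (k : ℕ) (u : LocalUnits K p), u ∈ W k ↔
      ∀ v, ∃ x : v.1.adicCompletionIntegers K,
        ((u v : (v.1.adicCompletionIntegers K)ˣ) : v.1.adicCompletionIntegers K) =
          1 + (p : v.1.adicCompletionIntegers K) ^ k * x)
    {k : ℕ} {w : LocalUnits K p} (hw : w ∈ W (k + 1)) : ∃ u ∈ W 1, u ^ p ^ k = w := by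
  induction k generalizing w with
  | zero => exact ⟨w, by simpa using hw, by rw [pow_zero, pow_one]⟩
  | succ k ih =>
    have hw' : w ∈ W (k + 2) := hw
    obtain ⟨u₁, hu₁, hu₁w⟩ := exists_pow_prime_eq_of_mem_W_odd hodd hW (k := k) hw'
    obtain ⟨u, hu, huu₁⟩ := ih hu₁
    exact ⟨u, hu, by rw [pow_succ, pow_mul, huu₁, hu₁w]⟩

/-- **One place, odd `p`: `1 + p^{k+1}𝒪_v ⊆ (1 + p𝒪_v)^{p^k}`** — for `v ∣ p` and `x ∈ 𝒪_v` there is a unit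
`u ≡ 1 (mod p𝒪_v)` of `𝒪_v` with `u^{p^k} = 1 + p^{k+1} x` (the product statement
`exists_pow_prime_pow_eq_of_mem_W_odd` for the congruence subgroups `W_k = ker (U_p → ∏_v (𝒪_v/p^k)ˣ)`, read at
the `v`-component of the element which is `1 + p^{k+1} x` at `v` and `1` elsewhere).
[cite: NeukirchANT1999, Ch. II (5.5)] [cite: Cox2013, Thm. 7.24] -/
theorem exists_units_pow_prime_pow_eq_one_add_odd (hodd : Odd p) (v : HeightOneSpectrum (𝓞 K))
    (hv : (p : 𝓞 K) ∈ v.asIdeal) (k : ℕ) (x : v.adicCompletionIntegers K) :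
    ∃ u : (v.adicCompletionIntegers K)ˣ,
      (∃ y : v.adicCompletionIntegers K, (u : v.adicCompletionIntegers K) = 1 + (p : v.adicCompletionIntegers K) * y) ∧
      ((u ^ p ^ k : (v.adicCompletionIntegers K)ˣ) : v.adicCompletionIntegers K) =
        1 + (p : v.adicCompletionIntegers K) ^ (k + 1) * x := by
  classical
  -- the congruence subgroups as kernels of reduction maps (as in `exists_openSubgroup_localUnits_equiv_holds`)
  let ρ : ∀ k : ℕ, LocalUnits K p →* ∀ w : placesAbove K p, (w.1.adicCompletionIntegers K ⧸
      Ideal.span {(p : w.1.adicCompletionIntegers K) ^ k})ˣ := fun k =>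
    MonoidHom.pi fun w => (Units.map (Ideal.Quotient.mk
      (Ideal.span {(p : w.1.adicCompletionIntegers K) ^ k})).toMonoidHom).comp
        (Pi.evalMonoidHom (fun w' : placesAbove K p => (w'.1.adicCompletionIntegers K)ˣ) w)
  let W : ℕ → Subgroup (LocalUnits K p) := fun k => (ρ k).ker
  have hW : ∀ (k : ℕ) (u : LocalUnits K p), u ∈ W k ↔
      ∀ w, ∃ x : w.1.adicCompletionIntegers K,
        ((u w : (w.1.adicCompletionIntegers K)ˣ) : w.1.adicCompletionIntegers K) =
          1 + (p : w.1.adicCompletionIntegers K) ^ k * x := by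
    intro k u
    change u ∈ (ρ k).ker ↔ _
    rw [MonoidHom.mem_ker, funext_iff]
    refine forall_congr' fun w => ?_
    rw [Pi.one_apply, Units.ext_iff]
    change Ideal.Quotient.mk (Ideal.span {(p : w.1.adicCompletionIntegers K) ^ k})
        (((u w : (w.1.adicCompletionIntegers K)ˣ) : w.1.adicCompletionIntegers K)) =
      Ideal.Quotient.mk (Ideal.span {(p : w.1.adicCompletionIntegers K) ^ k}) 1 ↔ _
    rw [Ideal.Quotient.eq, Ideal.mem_span_singleton']
    constructor
    · rintro ⟨z, hz⟩
      exact ⟨z, by rw [mul_comm] at hz; rw [hz, add_sub_cancel]⟩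
    · rintro ⟨z, hz⟩
      exact ⟨z, by rw [hz]; ring⟩
  -- the element `1 + p^(k+1) x` at `v`, `1` elsewhere
  let i₀ : placesAbove K p := ⟨v, hv⟩
  let u₀ : (v.adicCompletionIntegers K)ˣ := (isUnit_one_add_prime_pow_mul v hv k x).unit
  have hu₀ : (u₀ : v.adicCompletionIntegers K) = 1 + (p : v.adicCompletionIntegers K) ^ (k + 1) * x :=
    (isUnit_one_add_prime_pow_mul v hv k x).unit_spec
  let w₀ : LocalUnits K p := Pi.mulSingle i₀ u₀
  have hw₀ : w₀ ∈ W (k + 1) := by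
    rw [hW]
    intro w
    by_cases hwi : w = i₀
    · subst hwi
      refine ⟨x, ?_⟩
      change ((Pi.mulSingle i₀ u₀ : LocalUnits K p) i₀ : i₀.1.adicCompletionIntegers K) = _
      rw [Pi.mulSingle_eq_same]
      exact hu₀
    · refine ⟨0, ?_⟩
      change ((Pi.mulSingle i₀ u₀ : LocalUnits K p) w : w.1.adicCompletionIntegers K) = _
      rw [Pi.mulSingle_eq_of_ne hwi, Units.val_one, mul_zero, add_zero]
  obtain ⟨u, hu, huw⟩ := exists_pow_prime_pow_eq_of_mem_W_odd hodd hW hw₀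
  obtain ⟨y, hy⟩ := ((hW 1 u).1 hu) i₀
  refine ⟨u i₀, ⟨y, by rw [hy, pow_one]⟩, ?_⟩
  have h := congrFun huw i₀
  rw [Pi.pow_apply] at h
  rw [h]
  change ((Pi.mulSingle i₀ u₀ : LocalUnits K p) i₀ : v.adicCompletionIntegers K) = _
  rw [Pi.mulSingle_eq_same]
  exact hu₀

end Global

end PRamified

end Literature.NumberTheory.EllipticCurves
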